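import Summits.BirchSwinnertonDyer.BirchSwinnertonDyer.Theses.ShadowIsolation
import Summits.BirchSwinnertonDyer.BirchSwinnertonDyer.Theorems.ShadowIsolationIsolationOfAccidentalZerosStubDepthRigidity
import Summits.BirchSwinnertonDyer.BirchSwinnertonDyer.Theorems.ShadowIsolationIsolationOfAccidentalZerosStubRationalSectorFinite
import Literature.NumberTheory.EllipticCurves.EichlerShimuraCongruenceHondaProofs
import Literature.NumberTheory.EllipticCurves.NewformsCoeffFieldHolds
import HarnessLib

/-!
# ShadowIsolation · `IsolationOfAccidentalZeros` — the DEGREE SPLIT (crux-strategist s1)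

Support file for crux item `stmt-BirchSwinnertonDyer-15786`
(`Summit.BirchSwinnertonDyer.BirchSwinnertonDyer.Theses.ShadowIsolation.IsolationOfAccidentalZeros`).

The crux: for `W/ℚ` globally minimal elliptic and `p ≥ 5` good ordinary with `E[p]` irreducible,
beyond some depth `n₀` there is no even-sign newform `g ≠ f_W` of level `N_W·M` (`M` squarefree,
coprime to `p·N_W`) depth-`n` congruent to `W` with `L(g,1) = 0`.

Every analysis of this crux (line `birth`, line `orbit_dichotomy`, the strategy censuses) converges on
one structural fact: the only FINITENESS engine (Mordell–Faltings / Lang–Vojta: deep congruences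
`E[pⁿ] ↪ A_g` with `dim A_g` bounded are finite) sees congruent forms of BOUNDED coefficient degree
and is blind to sign and `L`-values, while the only RIGIDITY of central vanishing (Shimura 1977:
Galois-conjugate newforms vanish at `s = 1` together) bites only when the degree is LARGE. So the
crux splits along the degree `[ℚ(a_m(g)) : ℚ]` of the congruent form into two pieces of different
mathematical type, and the split itself is pure logic:

* piece 1, SMALL-DEGREE CONGRUENCE DEATH — for every `d`, deep congruences to `W` by raised newforms
  of degree `≤ d` die out (sign-free, `L`-free);
* piece 2, LARGE-DEGREE ISOLATION — for some `d₀`, deep EVEN congruent newforms of degree `> d₀` have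
  `L(g,1) ≠ 0` (the open core).

`IsolationOfAccidentalZeros_of_subs : piece₁ → piece₂ → IsolationOfAccidentalZeros` is proved with NO
further hypothesis: given `d₀, n₁` from piece 2 and `n₂ = n₂(d₀)` from piece 1, a putative accidental
zero at depth `n ≥ max n₁ n₂` either has degree `≤ d₀` (killed by piece 1) or not (killed by piece 2).
Both pieces are written INLINE, verbatim over the crux's own clauses (Mathlib +
`Literature…ModularForms.{heckeEigenvalue, IsNewform0, coeffField, cuspHeckeOperatorₗ, slToGLPos,
diagGL}`); the degree clause is
`FiniteDimensional ℚ (coeffField g) ∧ Module.finrank ℚ (coeffField g) ≤ d` (finite-dimensionality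
inside the predicate, so the junk value `finrank = 0` never counts as small degree). They are the
statements filed as the children `SmallDegreeCongruenceDeath` / `LargeDegreeIsolation` of the route's
split of this crux; `largeDegreeIsolation_of_isolationOfAccidentalZeros` records that piece 2 is a
CONSEQUENCE of the crux (drop the degree conjunct), and `smallDegreeCongruenceDeath_one` is the
`d = 1` RUNG of piece 1, proved modulo the registered facts `exists_isNewformOf` (modularity) and
`DeepCongruenceFinite` (Mordell–Faltings + Carayol) from the landed `Theorems.stub_rationalSectorFinite`
and `Theorems.stub_depthRigidity` (it is line `orbit_dichotomy`'s `rationalDeath` over the inlined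
degree clause).

[cite: Shimura1977, Thm. 1; Faltings1983; Carayol1989Duke, Thm. 3; IwaniecSarnak2000, Thm. 1]
-/

namespace Summit.BirchSwinnertonDyer.BirchSwinnertonDyer.Theorems

open scoped MatrixGroups ModularForm
open CongruenceSubgroup UpperHalfPlane
open Summit.BirchSwinnertonDyer.BirchSwinnertonDyer.Theses.ShadowIsolation
open Literature.NumberTheory.EllipticCurves Literature.NumberTheory.EllipticCurves.ModularForms

/-- **The degree split is exhaustive** (glue for `route edit --split IsolationOfAccidentalZeros --into
SmallDegreeCongruenceDeath LargeDegreeIsolation`): small-degree congruence death and large-degree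
isolation, stated INLINE exactly as filed on the route, give the crux BY NAME. Pure logic over the
crux's clauses — no modularity, no named fact. -/
theorem IsolationOfAccidentalZeros_of_subs :
    (∀ (W : WeierstrassCurve ℚ) [W.IsElliptic] [W.IsGloballyMinimal] (p : ℕ) [Fact p.Prime], 5 ≤ p → W.HasGoodReductionAtPrime p → ¬ (p : ℤ) ∣ W.frobeniusTrace p → W.HasIrreducibleModPGaloisRep p → ∀ d : ℕ, ∃ n₂ : ℕ, ∀ n : ℕ, n₂ ≤ n → ¬ ∃ (M : ℕ) (_ : NeZero (W.conductorNorm ℤ * M)) (g : CuspForm (CongruenceSubgroup.Gamma0 (W.conductorNorm ℤ * M)) 2) (R : Subring ℂ) (φ : R →+* ZMod (p ^ n)) (hR : ∀ ℓ : ℕ, ℓ.Prime → ¬ ℓ ∣ W.conductorNorm ℤ * M → Literature.NumberTheory.EllipticCurves.ModularForms.heckeEigenvalue g ℓ ∈ R), Squarefree M ∧ Nat.Coprime M (p * W.conductorNorm ℤ) ∧ Literature.NumberTheory.EllipticCurves.ModularForms.IsNewform0 g ∧ (FiniteDimensional ℚ (Literature.NumberTheory.EllipticCurves.ModularForms.coeffField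 g) ∧ Module.finrank ℚ (Literature.NumberTheory.EllipticCurves.ModularForms.coeffField g) ≤ d) ∧ (∃ m : ℕ, (UpperHalfPlane.qExpansion 1 ⇑g).coeff m ≠ ((W.LFunction m : ℤ) : ℂ)) ∧ (∀ (ℓ : ℕ) (hℓ : ℓ.Prime) (hℓL : ¬ ℓ ∣ W.conductorNorm ℤ * M), φ ⟨Literature.NumberTheory.EllipticCurves.ModularForms.heckeEigenvalue g ℓ, hR ℓ hℓ hℓL⟩ = ((W.frobeniusTrace ℓ : ℤ) : ZMod (p ^ n)))) →
    (∀ (W : WeierstrassCurve ℚ) [W.IsElliptic] [W.IsGloballyMinimal] (p : ℕ) [Fact p.Prime], 5 ≤ p → W.HasGoodReductionAtPrime p → ¬ (p : ℤ) ∣ W.frobeniusTrace p → W.HasIrreducibleModPGaloisRep p → ∃ d₀ n₁ : ℕ, ∀ n : ℕ, n₁ ≤ n → ¬ ∃ (M : ℕ) (_ : NeZero (W.conductorNorm ℤ * M)) (g : CuspForm (CongruenceSubgroup.Gamma0 (W.conductorNorm ℤ * M)) 2) (R : Subring ℂ) (φ : R →+* ZMod (p ^ n)) (hR : ∀ ℓ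 : ℕ, ℓ.Prime → ¬ ℓ ∣ W.conductorNorm ℤ * M → Literature.NumberTheory.EllipticCurves.ModularForms.heckeEigenvalue g ℓ ∈ R), Squarefree M ∧ Nat.Coprime M (p * W.conductorNorm ℤ) ∧ Literature.NumberTheory.EllipticCurves.ModularForms.IsNewform0 g ∧ ¬ (FiniteDimensional ℚ (Literature.NumberTheory.EllipticCurves.ModularForms.coeffField g) ∧ Module.finrank ℚ (Literature.NumberTheory.EllipticCurves.ModularForms.coeffField g) ≤ d₀) ∧ (∃ m : ℕ, (UpperHalfPlane.qExpansion 1 ⇑g).coeff m ≠ ((W.LFunction m : ℤ) : ℂ)) ∧ Literature.NumberTheory.EllipticCurves.ModularForms.cuspHeckeOperatorₗ (CongruenceSubgroup.Gamma0 (W.conductorNorm ℤ * M)) 2 (Literature.NumberTheory.EllipticCurves.ModularForms.slToGLPos ModularGroup.S * Literature.NumberTheory.EllipticCurves.ModularForms.diagGL ((W.conductorNorm ℤ * M : ℕ) : ℚ) 1 (Nat.cast_pos.mpr (NeZero.pos (W.conductorNorm ℤ * M))) one_pos) g = -g ∧ (∀ (ℓ : ℕ) (hℓ : ℓ.Prime)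 (hℓL : ¬ ℓ ∣ W.conductorNorm ℤ * M), φ ⟨Literature.NumberTheory.EllipticCurves.ModularForms.heckeEigenvalue g ℓ, hR ℓ hℓ hℓL⟩ = ((W.frobeniusTrace ℓ : ℤ) : ZMod (p ^ n))) ∧ ∃ Λ : ℂ → ℂ, Differentiable ℂ Λ ∧ (∀ s : ℂ, 2 < s.re → Λ s = LSeries (fun m ↦ (UpperHalfPlane.qExpansion 1 ⇑g).coeff m) s) ∧ Λ 1 = 0) →
    IsolationOfAccidentalZeros := by
  intro h₁ h₂ W _ _ p _ h5 hgood hord hirr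
  obtain ⟨d₀, n₁, H₂⟩ := h₂ W p h5 hgood hord hirr
  obtain ⟨n₂, H₁⟩ := h₁ W p h5 hgood hord hirr d₀
  refine ⟨max n₁ n₂, fun n hn hex => ?_⟩
  obtain ⟨M, hM, g, R, φ, hR, hsq, hcop, hnew, hmis, hsign, hcong, hzero⟩ := hex
  by_cases hdeg : (FiniteDimensional ℚ (coeffField g) ∧ Module.finrank ℚ (coeffField g) ≤ d₀)
  · exact H₁ n (le_of_max_le_right hn) ⟨M, hM, g, R, φ, hR, hsq, hcop, hnew, hdeg, hmis, hcong⟩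
  · exact H₂ n (le_of_max_le_left hn)
      ⟨M, hM, g, R, φ, hR, hsq, hcop, hnew, hdeg, hmis, hsign, hcong, hzero⟩

/-- Piece 2 is a CONSEQUENCE of the crux (drop the degree conjunct): `LargeDegreeIsolation` is the
crux weakened by one conjunct under the negation, so it is strictly on the path (`S → C` direction of
the birth-certificate probe), while piece 1 (sign-free, `L`-free) is not implied by the crux. -/
theorem largeDegreeIsolation_of_isolationOfAccidentalZeros (h : IsolationOfAccidentalZeros) :
    (∀ (W : WeierstrassCurve ℚ) [W.IsElliptic] [W.IsGloballyMinimal] (p : ℕ) [Fact p.Prime], 5 ≤ p → W.HasGoodReductionAtPrime p → ¬ (p : ℤ) ∣ W.frobeniusTrace p → W.HasIrreducibleModPGaloisRep p → ∃ d₀ n₁ : ℕ, ∀ n : ℕ, n₁ ≤ n → ¬ ∃ (M : ℕ) (_ : NeZero (W.conductorNorm ℤ * M)) (g : CuspForm (CongruenceSubgroup.Gamma0 (W.conductorNorm ℤ * M)) 2) (R : Subring ℂ) (φ : R →+* ZMod (p ^ n)) (hR : ∀ ℓ : ℕ, ℓ.Prime → ¬ ℓ ∣ W.conductorNorm ℤ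 * M → Literature.NumberTheory.EllipticCurves.ModularForms.heckeEigenvalue g ℓ ∈ R), Squarefree M ∧ Nat.Coprime M (p * W.conductorNorm ℤ) ∧ Literature.NumberTheory.EllipticCurves.ModularForms.IsNewform0 g ∧ ¬ (FiniteDimensional ℚ (Literature.NumberTheory.EllipticCurves.ModularForms.coeffField g) ∧ Module.finrank ℚ (Literature.NumberTheory.EllipticCurves.ModularForms.coeffField g) ≤ d₀) ∧ (∃ m : ℕ, (UpperHalfPlane.qExpansion 1 ⇑g).coeff m ≠ ((W.LFunction m : ℤ) : ℂ)) ∧ Literature.NumberTheory.EllipticCurves.ModularForms.cuspHeckeOperatorₗ (CongruenceSubgroup.Gamma0 (W.conductorNorm ℤ * M)) 2 (Literature.NumberTheory.EllipticCurves.ModularForms.slToGLPos ModularGroup.S * Literature.NumberTheory.EllipticCurves.ModularForms.diagGL ((W.conductorNorm ℤ * M : ℕ) : ℚ) 1 (Nat.cast_pos.mpr (NeZero.pos (W.conductorNorm ℤ * M))) one_pos) g = -g ∧ (∀ (ℓ : ℕ) (hℓ : ℓ.Prime) (hℓL : ¬ ℓ ∣ W.conductorNorm ℤ * M), φ ⟨Literature.NumberTheory.EllipticCurves.ModularForms.heckeEigenvalue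 g ℓ, hR ℓ hℓ hℓL⟩ = ((W.frobeniusTrace ℓ : ℤ) : ZMod (p ^ n))) ∧ ∃ Λ : ℂ → ℂ, Differentiable ℂ Λ ∧ (∀ s : ℂ, 2 < s.re → Λ s = LSeries (fun m ↦ (UpperHalfPlane.qExpansion 1 ⇑g).coeff m) s) ∧ Λ 1 = 0) := by
  intro W _ _ p _ h5 hgood hord hirr
  obtain ⟨n₀, H⟩ := h W p h5 hgood hord hirr
  refine ⟨0, n₀, fun n hn hex => ?_⟩
  obtain ⟨M, hM, g, R, φ, hR, hsq, hcop, hnew, -, hmis, hsign, hcong, hzero⟩ := hex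
  exact H n hn ⟨M, hM, g, R, φ, hR, hsq, hcop, hnew, hmis, hsign, hcong, hzero⟩

/-- A newform whose coefficient field has degree `≤ 1` has INTEGER `q`-expansion (coefficient field
`= ℚ`, coefficients algebraic integers by Shimura 1971 Thm. 3.48 = `IsNewform0.isIntegral_coeff_holds`,
and `ℤ` is integrally closed). -/
theorem intCoeff_of_degree_le_one {L : ℕ} [NeZero L] {g : CuspForm (Gamma0 L) 2}
    (hg : IsNewform0 g)
    (h : FiniteDimensional ℚ (coeffField g) ∧ Module.finrank ℚ (coeffField g) ≤ 1) :
    ∀ m : ℕ, ∃ a : ℤ, (qExpansion 1 ⇑g).coeff m = (a : ℂ) := by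
  intro m
  obtain ⟨hfd, hle⟩ := h
  haveI := hfd
  have h1 : Module.finrank ℚ (coeffField g) = 1 := le_antisymm hle Module.finrank_pos
  have hbot : coeffField g = ⊥ := IntermediateField.finrank_eq_one_iff.mp h1
  have hmem : (qExpansion 1 ⇑g).coeff m ∈ (⊥ : IntermediateField ℚ ℂ) :=
    hbot ▸ coeff_mem_coeffField g m
  rw [IntermediateField.mem_bot] at hmem
  obtain ⟨q, hq⟩ := hmem
  have hint : IsIntegral ℤ ((qExpansion 1 ⇑g).coeff m) := IsNewform0.isIntegral_coeff_holds hg m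
  rw [← hq] at hint
  have hqint : IsIntegral ℤ q :=
    (isIntegral_algebraMap_iff (algebraMap ℚ ℂ).injective).mp hint
  obtain ⟨a, ha⟩ := (IsIntegrallyClosed.isIntegral_iff (R := ℤ) (K := ℚ)).mp hqint
  refine ⟨a, ?_⟩
  rw [← hq, ← ha]
  simp

/-- **The `d = 1` rung of piece 1** (BC5 witness for `SmallDegreeCongruenceDeath`): GIVEN modularity
(`exists_isNewformOf`, BCDT 2001) and the finiteness of deep congruences to a fixed curve
(`DeepCongruenceFinite`, Mordell–Faltings + Carayol), deep congruences to `W` by raised newforms of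
degree `≤ 1` with a `q`-expansion mismatch die out. Proof = line `orbit_dichotomy`'s `rationalDeath`:
the finitely many integral-`q`-expansion congruent pairs at the depth supplied by
`Theorems.stub_rationalSectorFinite` each die at some depth by `Theorems.stub_depthRigidity`; take the
maximum. -/
theorem smallDegreeCongruenceDeath_one (hMod : exists_isNewformOf) (hDC : DeepCongruenceFinite) :
    ∀ (W : WeierstrassCurve ℚ) [W.IsElliptic] [W.IsGloballyMinimal] (p : ℕ) [Fact p.Prime], 5 ≤ p → W.HasGoodReductionAtPrime p → ¬ (p : ℤ) ∣ W.frobeniusTrace p → W.HasIrreducibleModPGaloisRep p → ∃ n₂ : ℕ, ∀ n : ℕ, n₂ ≤ n → ¬ ∃ (M : ℕ) (_ : NeZero (W.conductorNorm ℤ * M)) (g : CuspForm (CongruenceSubgroup.Gamma0 (W.conductorNorm ℤ * M)) 2) (R : Subring ℂ) (φ : R →+* ZMod (p ^ n)) (hR : ∀ ℓ : ℕ, ℓ.Prime → ¬ ℓ ∣ W.conductorNorm ℤ * M → Literature.NumberTheory.EllipticCurves.ModularForms.heckeEigenvalue g ℓ ∈ R), Squarefree M ∧ Nat.Coprime M (p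 * W.conductorNorm ℤ) ∧ Literature.NumberTheory.EllipticCurves.ModularForms.IsNewform0 g ∧ (FiniteDimensional ℚ (Literature.NumberTheory.EllipticCurves.ModularForms.coeffField g) ∧ Module.finrank ℚ (Literature.NumberTheory.EllipticCurves.ModularForms.coeffField g) ≤ 1) ∧ (∃ m : ℕ, (UpperHalfPlane.qExpansion 1 ⇑g).coeff m ≠ ((W.LFunction m : ℤ) : ℂ)) ∧ (∀ (ℓ : ℕ) (hℓ : ℓ.Prime) (hℓL : ¬ ℓ ∣ W.conductorNorm ℤ * M), φ ⟨Literature.NumberTheory.EllipticCurves.ModularForms.heckeEigenvalue g ℓ, hR ℓ hℓ hℓL⟩ = ((W.frobeniusTrace ℓ : ℤ) : ZMod (p ^ n))) := by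
  intro W _ _ p _ h5 hgood hord hirr
  classical
  have hES : eichlerShimuraConstruction := eichlerShimuraConstruction_of_exists_isNewformOf hMod
  obtain ⟨nr, hr⟩ := Theorems.stub_rationalSectorFinite hES hDC W p h5 hgood hord hirr
  -- every member of the finite rational set dies at some depth once its `q`-expansion is not `W`'s
  have hdie : ∀ x ∈ hr.toFinset, ∃ k : ℕ,
      (∃ m : ℕ, (qExpansion 1 ⇑(x.2)).coeff m ≠ ((W.LFunction m : ℤ) : ℂ)) →
        ∀ j : ℕ, k ≤ j → ∀ (_ : NeZero (W.conductorNorm ℤ * x.1)) (R : Subring ℂ)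
          (φ : R →+* ZMod (p ^ j))
          (hR : ∀ ℓ : ℕ, ℓ.Prime → ¬ ℓ ∣ W.conductorNorm ℤ * x.1 → heckeEigenvalue x.2 ℓ ∈ R),
          ¬ ∀ (ℓ : ℕ) (hℓ : ℓ.Prime) (hℓL : ¬ ℓ ∣ W.conductorNorm ℤ * x.1),
              φ ⟨heckeEigenvalue x.2 ℓ, hR ℓ hℓ hℓL⟩ = ((W.frobeniusTrace ℓ : ℤ) : ZMod (p ^ j)) := by
    rintro ⟨M, g⟩ hx
    rw [Set.Finite.mem_toFinset] at hx
    obtain ⟨hM, -, -, -, -, -, -, hnew, -⟩ := hx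
    haveI := hM
    by_cases hmis : ∃ m : ℕ, (qExpansion 1 ⇑g).coeff m ≠ ((W.LFunction m : ℤ) : ℂ)
    · obtain ⟨k, hk⟩ := Theorems.stub_depthRigidity hMod W p M g hnew hmis
      refine ⟨k, fun _ j hkj _ R φ hR hcong => ?_⟩
      refine hk R ((ZMod.castHom (pow_dvd_pow p hkj) (ZMod (p ^ k))).comp φ) hR ?_
      intro ℓ hℓ hℓL
      rw [RingHom.comp_apply, hcong ℓ hℓ hℓL, map_intCast]
    · exact ⟨0, fun h => (hmis h).elim⟩
  choose! f hf using hdie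
  refine ⟨max nr (hr.toFinset.sup f), fun n hn hex => ?_⟩
  obtain ⟨M, hM, g, R, φ, hR, hsq, hcop, hnew, hdeg, hmis, hcong⟩ := hex
  haveI := hM
  have hint : ∀ m : ℕ, ∃ a : ℤ, (qExpansion 1 ⇑g).coeff m = (a : ℂ) :=
    intCoeff_of_degree_le_one hnew hdeg
  have hnr : nr ≤ n := (le_max_left _ _).trans hn
  -- `(M, g)` lies in the finite rational set: restrict the congruence to depth `nr ≤ n`
  have hx : (⟨M, g⟩ : Σ M : ℕ, CuspForm (CongruenceSubgroup.Gamma0 (W.conductorNorm ℤ * M)) 2) ∈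
      hr.toFinset := by
    rw [Set.Finite.mem_toFinset]
    refine ⟨hM, R, (ZMod.castHom (pow_dvd_pow p hnr) (ZMod (p ^ nr))).comp φ, hR, hint, hsq, hcop,
      hnew, ?_⟩
    intro ℓ hℓ hℓL
    rw [RingHom.comp_apply, hcong ℓ hℓ hℓL, map_intCast]
  have hle : f ⟨M, g⟩ ≤ n :=
    (Finset.le_sup (f := f) hx).trans ((le_max_right _ _).trans hn)
  exact hf _ hx hmis n hle hM R φ hR hcong

end Summit.BirchSwinnertonDyer.BirchSwinnertonDyer.Theorems
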